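import Literature.MathematicalPhysics.QuantumFieldTheory.Balaban1983to89.B8Thm4UniqueE

/-!
# `Balaban1983to89.B8Thm4UniqueELan` — [Balaban1985RegularSpaces] THEOREM 4 (p. 88) ∕ THEOREM 8 (p. 101), UNIQUENESS CLAUSE `u₁ = u₂` ON THE
# CONCRETE `ℤᵈ × 𝔸` CARRIERS FOR AN ARBITRARY GAUGE PREDICATE `Lan`, MODULO PROPOSITION 5'S UNIQUENESS CLAUSE (1.109) IN THE REPAIRED SOCKET
# CURRENCY (`SockP5uE`)

statement-level skeleton of published theorems with citation tags; proofs where landed; nothing here is a claim about the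
Yang–Mills mass gap

PDF held: `paper:balaban1985-cmp99-regular-spaces-gauge-fixing` (journal page = PDF page + 74); p. 88 (Theorem 4), p. 94 (Prop. 5,
(1.107)–(1.109)), p. 95 (the uniqueness paragraph after (1.112)), p. 101 (Theorem 8, (1.146)).

WHY THIS FILE (cell `pub-ymgap`, HUMAN RULING D-0062; R134 acceleration seat `pub-ymgap-dag-n05-d` (g5) = the PROVIDER of the Proposition-5 sockets
of the Theorem-8 knit in the H currency).  The sourced Theorem-4∕8 chain of record (`B8Thm4ConcreteLan.thm4Body_concrete_uniform_lan` →
`B8Thm4CoreZd3Lan.thm4Core_zd3_lan` → `B8Thm8SurvivingZd3H.thm8SurvivingAt_zd3H_univ_lan`, consumer `B8Prop3GaugeFixedKLevelSrc.thm4_unique_eq_lan`)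
reads Proposition 5's uniqueness through a socket `SP5u` in the PRE-E tower-local currency of `B8Thm4SupportLocal.thm4_unique_eq_landau138`
(competitors' `λ, μ` on the towers `Bʲ(y)` only, gradient clause on tower-internal bonds, no (1.62)-datum bound) — the currency n04-b g5 located as
NOT servable by the contraction of record ((1.102)'s norm reads every bond touching `Ω_j`) and n05-a g7 repaired on the consumer side
(`B8Thm4UniqueE.thm4_unique_eq_landau138E`, `B8Thm4ConcreteE`).  THIS FILE is the one consumer lemma the E-currency re-knit of the sourced chain
needs: **`thm4_unique_eq_lanE`** = `thm4_unique_eq_landau138E` with `IsLandau138W … ·` ↦ an arbitrary `Lan`, proof verbatim (the predicate is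
pass-through).  With it, `thm4Body_concrete_uniform_lan`'s last line swaps `thm4_unique_eq_lan` for `thm4_unique_eq_lanE` (handing `hu'S`, `hLan'`,
`h162'` to the socket as `B8Thm4ConcreteE` l. 256 does), and the `SP5u` binder becomes `SockP5uE`'s text at `LanF` — which this seat's sourced
uniqueness body `B8SockP5uEAssemblyBSrc.sockP5uE_body_of_join_b_src` and provider `B8SockSP5uProviderSrc` serve.

HONEST SCOPE.  Consumer-side re-typing only (one binder generalised); Proposition 5 (either half) is NOT proved here (it is the hypothesis `hP5u`);
Proposition 3, (1.42), (1.59) untouched; constants as in `B8Thm4UniqueLocal`.  Count-neutral; N05 NOT discharged; one finite T⁴ programme at fixed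
ε; nothing continuum / ℝ⁴ / OS / mass-gap / Clay.  Unit `pub-ymgap-dag-n05-d` (g5), 2026-08-27.  No `sorry`, no `def`, no `instance`, no `notation`.
-/

noncomputable section

open NormedSpace

namespace Literature.MathematicalPhysics.QuantumFieldTheory.Balaban1983to89.B8Thm4UniqueELan

open Complex (I I_ne_zero)
open MatrixLog B7Prop1Explicit B7Prop2Explicit B7Prop1Local B7Eq92Concrete
open B7Prop2Explicit (C0 c2')
open B7Prop3Flat (c3)
open B8Ineq130 (tlo thi)
open B8Ineq132 (covDerivFwd InAk)
open B8Eq119TwistedAxial (InAx Restr129)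
open B8Eq184Proof (gaugeExp cfgExp)
open B8Eq140Level (SideTouches sideTouches_of_bondTouches)
open B8Ineq1109Local (ineq1109_scaled lam_of_unit mgauge_quotient_eq)
open B8Thm4UniqueLocal (lam_in_domain_of_agree)
open B8Thm4AtLandau138 (pdevOn_tower_lt_of_inAk mgauge_mgauge_inv)
open B8Thm4UniqueE (quotient_eq_one_off lam_zero_off)

-- `Site` alone could resolve to the torus sites of `Setup.lean`; re-export the `ℤ^d` sites of `B7Prop1Explicit`.
export B7Prop1Explicit (Site)

variable {d : ℕ}

section Main

variable {𝔸 : Type*} [CStarAlgebra 𝔸] [Nontrivial 𝔸]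
variable {L k : ℕ} {η : ℝ} {Ω : ℕ → Set (Site d)} {Λ : ℕ → Set (Site d)} {U₀ U' : Site d → Fin d → 𝔸ˣ} {α₀ αP c : ℝ}
  {u₁ u₂ : Site d → 𝔸ˣ}

/-- **THEOREM 4's ∕ THEOREM 8's UNIQUENESS CLAUSE AS AN EQUALITY `u₁ = u₂`, ARBITRARY GAUGE PREDICATE `Lan`, PROPOSITION 5's UNIQUENESS
SOCKET IN THE REPAIRED (E) CURRENCY** — `B8Thm4UniqueE.thm4_unique_eq_landau138E` VERBATIM with the Landau condition of record
`IsLandau138W L k η Ω₀ Λ U₀ ·` replaced by an ARBITRARY predicate `Lan` on configurations (it is pass-through: read for the two gauge-fixed fields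
`U′^{u_i⁻¹}` and handed to the socket for the two competitors `u′ = u₁⁻¹u₂` and `1`), exactly as n05-c's `B8Prop3GaugeFixedKLevelSrc.thm4_unique_eq_lan`
generalises the pre-E `B8Thm4SupportLocal.thm4_unique_eq_landau138`.  The socket hypothesis `hP5u` is in the currency of
`B8LeafModelZdSockP5uE.SockP5uE` (competitors read at EVERY site, `λ = 0` off `Ω₀`, `(Lʲη)|(D_{U₀}λ)(b)| < c_u` on every bond of `SideTouches (Ω j)`),
the one the Proposition-5 uniqueness JOIN of record serves (`B8Prop5UniqSectEW(Src)`, `B8SockP5uEAssemblyB(Src)`).  At `Lan := IsLandau146W … f ·`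
(top level of `B8LanF146.LanF146`): Theorem 8's «exactly one» among restricted competitors, modulo the sourced socket.  PROOF = print's paragraph
p. 95 verbatim as in the E file: `u′ := u₁⁻¹u₂` solves (1.107), `λ′ := i⁻¹ log u′` lies in the domain (towers: `lam_in_domain_of_agree`; off `Ω₀`:
`lam_zero_off`; bonds: `ineq1109_scaled`), so does `1`; hence `u′ = 1`.
[cite: Balaban1985RegularSpaces, Thm 4 p.88 («exactly one»), Thm 8 p.101, proof p.95 (1.112), (1.29) p.81, (1.62) p.87, Prop. 5 (1.107)–(1.109) p.94, (1.77) p.90] -/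
theorem thm4_unique_eq_lanE (hd2 : 2 ≤ d) (hL : 2 ≤ L) (hη : 0 < η)
    (hU₀ : ∀ x κ, U₀ x κ ∈ unitaryUnits 𝔸) (hU' : ∀ x κ, U' x κ ∈ unitaryUnits 𝔸)
    (hu₁ : ∀ x, u₁ x ∈ unitaryUnits 𝔸) (hu₂ : ∀ x, u₂ x ∈ unitaryUnits 𝔸)
    (hα : 0 < α₀) (hα3 : C0 d * α₀ ≤ 1 / 3) (hα4 : 4 * α₀ ≤ c2' d L) (hc : 0 ≤ c)
    (hsmall : Real.exp (4 * (800 * ((d : ℝ) + 1) ^ 2 * ((d : ℝ) + 4)) * α₀) * (1 + 8 * (131072 * ((d : ℝ) + 1) ^ 2) * c) ≤ 2)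
    (hc₃ : 2 * c ≤ c3 d L) (hsm : 2048 * (d : ℝ) * c ≤ 1) (hα₃ : 40 * d * c ≤ 1 / 5000)
    (hαP : 0 < αP) (hαP3 : C0 d * αP ≤ 1 / 3) (hαP2 : 2 * αP ≤ c2' d L)
    {cu : ℝ} (hcu₁ : 2 * (2 * (40 * d * c) + 2 * 1116 * (40 * d * c) ^ 2) < cu) (hcu₂ : 5 * c < cu)
    (h33 : InAk L k η α₀ Ω U₀) (h34 : InAk L k η αP Ω (U' * U₀)) (hAx : InAx L k Λ U₀ (U' * U₀))
    (htower : ∀ j, j ≤ k → ∀ y ∈ Λ j, ∀ x, InBox (tlo L y j) (thi L y j) x → x ∈ Ω j)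
    (h129₁ : Restr129 L k Λ U₀ u₁) (h129₂ : Restr129 L k Λ U₀ u₂)
    (Lan : (Site d → Fin d → 𝔸ˣ) → Prop)
    (hLan₁ : Lan (mgauge U₀ u₁⁻¹ U')) (hLan₂ : Lan (mgauge U₀ u₂⁻¹ U'))
    (h162₁ : ∃ A₁ : Site d → Fin d → 𝔸, ∀ j, j ≤ k → ∀ (x : Site d) (κ : Fin d), SideTouches (Ω j) x κ →
      mgauge U₀ u₁⁻¹ U' x κ = cfgExp η A₁ x κ ∧ ‖A₁ x κ‖ ≤ c * ((L : ℝ) ^ j * η)⁻¹)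
    (h162₂ : ∃ A₂ : Site d → Fin d → 𝔸, ∀ j, j ≤ k → ∀ (x : Site d) (κ : Fin d), SideTouches (Ω j) x κ →
      mgauge U₀ u₂⁻¹ U' x κ = cfgExp η A₂ x κ ∧ ‖A₂ x κ‖ ≤ c * ((L : ℝ) ^ j * η)⁻¹)
    (hP5u : ∀ (v w : Site d → 𝔸ˣ) (lam mu : Site d → 𝔸),
      (∀ x, ((gaugeExp lam x : 𝔸ˣ) : 𝔸) = ((v x : 𝔸ˣ) : 𝔸) ∧ IsSelfAdjoint (lam x) ∧ ‖lam x‖ < cu) → (∀ x, x ∉ Ω 0 → lam x = 0) →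
      (∀ j, j ≤ k → ∀ b ∈ {b : Site d × Fin d | SideTouches (Ω j) b.1 b.2}, ((L : ℝ) ^ j * η) * ‖covDerivFwd η U₀ b.2 lam b.1‖ < cu) →
      (∀ x, ((gaugeExp mu x : 𝔸ˣ) : 𝔸) = ((w x : 𝔸ˣ) : 𝔸) ∧ IsSelfAdjoint (mu x) ∧ ‖mu x‖ < cu) → (∀ x, x ∉ Ω 0 → mu x = 0) →
      (∀ j, j ≤ k → ∀ b ∈ {b : Site d × Fin d | SideTouches (Ω j) b.1 b.2}, ((L : ℝ) ^ j * η) * ‖covDerivFwd η U₀ b.2 mu b.1‖ < cu) →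
      Lan (mgauge U₀ v⁻¹ (mgauge U₀ u₁⁻¹ U')) → Restr129 L k Λ U₀ (u₁ * v) →
      Lan (mgauge U₀ w⁻¹ (mgauge U₀ u₁⁻¹ U')) → Restr129 L k Λ U₀ (u₁ * w) →
      ∀ x, v x = w x)
    (hpart : ∀ x, x ∈ Ω 0 → ∃ j, j ≤ k ∧ ∃ y ∈ Λ j, InBox (tlo L y j) (thi L y j) x)
    (hu₁S : ∀ x, x ∉ Ω 0 → u₁ x = 1) (hu₂S : ∀ x, x ∉ Ω 0 → u₂ x = 1) :
    u₁ = u₂ := by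
  have hL1 : 1 ≤ L := le_trans (by norm_num) hL
  have hd : 1 ≤ d := le_trans (by norm_num) hd2
  have hd' : (1 : ℝ) ≤ d := by exact_mod_cast hd
  haveI : Nontrivial (Fin d) := Fin.nontrivial_iff_two_le.mpr hd2
  obtain ⟨A₁, hA₁⟩ := h162₁
  obtain ⟨A₂, hA₂⟩ := h162₂
  -- the two gauge-fixed fields `U_i = U′^{u_i⁻¹}` as opaque names
  obtain ⟨U₁, hU₁def⟩ : ∃ U₁ : Site d → Fin d → 𝔸ˣ, U₁ = mgauge U₀ u₁⁻¹ U' := ⟨_, rfl⟩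
  obtain ⟨U₂, hU₂def⟩ : ∃ U₂ : Site d → Fin d → 𝔸ˣ, U₂ = mgauge U₀ u₂⁻¹ U' := ⟨_, rfl⟩
  have h₁ : mgauge U₀ u₁ U₁ = U' := by rw [hU₁def]; exact mgauge_mgauge_inv U₀ U' u₁
  have h₂ : mgauge U₀ u₂ U₂ = U' := by rw [hU₂def]; exact mgauge_mgauge_inv U₀ U' u₂
  have hA₁' : ∀ j, j ≤ k → ∀ (x : Site d) (κ : Fin d), SideTouches (Ω j) x κ →
      U₁ x κ = cfgExp η A₁ x κ ∧ ‖A₁ x κ‖ ≤ c * ((L : ℝ) ^ j * η)⁻¹ := by rw [hU₁def]; exact hA₁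
  have hA₂' : ∀ j, j ≤ k → ∀ (x : Site d) (κ : Fin d), SideTouches (Ω j) x κ →
      U₂ x κ = cfgExp η A₂ x κ ∧ ‖A₂ x κ‖ ≤ c * ((L : ℝ) ^ j * η)⁻¹ := by rw [hU₂def]; exact hA₂
  -- a bond inside a tower `Bʲ(y) ⊂ Ω_j` is a side of a plaquette touching `Ω_j`
  have hside : ∀ j, j ≤ k → ∀ y ∈ Λ j, ∀ (x : Site d) (κ : Fin d), InBox (tlo L y j) (thi L y j) x →
      SideTouches (Ω j) x κ := by
    intro j hj y hy x κ hx
    obtain ⟨κ', hκ'⟩ := exists_ne κ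
    exact sideTouches_of_bondTouches hκ' (Or.inl (htower j hj y hy x hx))
  -- the threshold bookkeeping of `B8Thm4UniqueLocal`
  have ha₃0 : 0 ≤ 40 * d * c := by positivity
  set a₃ : ℝ := 2 * (40 * d * c) + 2 * 1116 * (40 * d * c) ^ 2 with ha₃
  have ha₃nn : 0 ≤ a₃ := by rw [ha₃]; positivity
  have hα₃' : 40 * d * c ≤ 1 / 3000 := hα₃.trans (by norm_num)
  have ha₃le : a₃ ≤ 1 / 2000 := by rw [ha₃]; nlinarith
  have hs : 2 * a₃ ≤ 1 / 1000 := by linarith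
  have hc170 : ∀ j : ℕ, c * ((L : ℝ) ^ j)⁻¹ ≤ 1 / 170 := by
    intro j
    have hLr : (1 : ℝ) ≤ L := by exact_mod_cast hL1
    have hLj : (1 : ℝ) ≤ (L : ℝ) ^ j := one_le_pow₀ hLr
    have hinv : ((L : ℝ) ^ j)⁻¹ ≤ 1 := inv_le_one_of_one_le₀ hLj
    have hc' : c ≤ 1 / 170 := by nlinarith
    calc c * ((L : ℝ) ^ j)⁻¹ ≤ c * 1 := mul_le_mul_of_nonneg_left hinv hc
      _ ≤ 1 / 170 := by linarith
  set lam : Site d → 𝔸 := fun z => (I⁻¹ : ℂ) • mlog ((((u₁⁻¹ * u₂) z : 𝔸ˣ)) : 𝔸) with hlam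
  -- ON THE TOWERS: `lam_in_domain_of_agree` (sitewise clause and tower-internal gradients)
  have htw : ∀ j, j ≤ k → ∀ y ∈ Λ j, ∀ x : Site d, InBox (tlo L y j) (thi L y j) x →
      ((gaugeExp lam x : 𝔸ˣ) : 𝔸) = (((u₁⁻¹ * u₂) x : 𝔸ˣ) : 𝔸) ∧ IsSelfAdjoint (lam x) ∧ ‖lam x‖ ≤ 2 * a₃ := by
    intro j hjk y hy x hx
    obtain ⟨he, hsa, hn, -⟩ := lam_in_domain_of_agree hd hL hL1 hη hU₀ hU' hu₁ hu₂ hα hα3 hα4 hc hsmall hc₃ hsm hα₃ hαP hαP3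
      hαP2 hAx h129₁ h129₂ h₁ h₂ hjk hy
      (pdevOn_tower_lt_of_inAk hL1 hα h33 hjk (htower j hjk y hy))
      (pdevOn_tower_lt_of_inAk hL1 hαP h34 hjk (htower j hjk y hy))
      (fun x κ hx _ => (hA₁' j hjk x κ (hside j hjk y hy x κ hx)).1)
      (fun x κ hx _ => (hA₂' j hjk x κ (hside j hjk y hy x κ hx)).1)
      (fun x κ hx _ => (hA₁' j hjk x κ (hside j hjk y hy x κ hx)).2)
      (fun x κ hx _ => (hA₂' j hjk x κ (hside j hjk y hy x κ hx)).2) x hx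
    exact ⟨he, hsa, hn⟩
  -- AT EVERY SITE: a site of `Ω₀` lies in a tower (partition clause); off `Ω₀` the logarithm vanishes
  have hsite : ∀ x : Site d,
      ((gaugeExp lam x : 𝔸ˣ) : 𝔸) = (((u₁⁻¹ * u₂) x : 𝔸ˣ) : 𝔸) ∧ IsSelfAdjoint (lam x) ∧ ‖lam x‖ ≤ 2 * a₃ := by
    intro x
    by_cases hx : x ∈ Ω 0
    · obtain ⟨j, hj, y, hy, hxy⟩ := hpart x hx
      exact htw j hj y hy x hxy
    · obtain ⟨h0, he⟩ := lam_zero_off hu₁S hu₂S hx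
      refine ⟨he, ?_, ?_⟩
      · show IsSelfAdjoint (lam x)
        rw [hlam]
        simp only
        rw [h0]
        exact IsSelfAdjoint.zero 𝔸
      · show ‖lam x‖ ≤ 2 * a₃
        rw [hlam]
        simp only
        rw [h0, norm_zero]
        positivity
  have hoff : ∀ x, x ∉ Ω 0 → lam x = 0 := fun x hx => (lam_zero_off hu₁S hu₂S hx).1
  -- AT EVERY BOND TOUCHING `Ω_j`: (1.112)'s bond estimate, fed by (1.62) at the bond and `|λ′| ≤ 2α₃′` at both endpoints
  have hq : mgauge U₀ (u₁⁻¹ * u₂)⁻¹ U₁ = U₂ := mgauge_quotient_eq U₀ u₁ u₂ U₁ U₂ U' h₁ h₂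
  have hG : AvgClosed d L (unitaryUnits 𝔸) := avgClosed_unitaryUnits d L
  have hgrad : ∀ j, j ≤ k → ∀ b ∈ {b : Site d × Fin d | SideTouches (Ω j) b.1 b.2},
      ((L : ℝ) ^ j * η) * ‖covDerivFwd η U₀ b.2 lam b.1‖ ≤ 5 * c := by
    intro j hj b hb
    obtain ⟨x, κ⟩ := b
    simp only [Set.mem_setOf_eq] at hb
    obtain ⟨hex, -, hnx⟩ := hsite x
    obtain ⟨hexe, -, hnxe⟩ := hsite (x + e κ)
    have hux : gaugeExp lam x = (u₁⁻¹ * u₂) x := Units.ext hex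
    have huxe : gaugeExp lam (x + e κ) = (u₁⁻¹ * u₂) (x + e κ) := Units.ext hexe
    obtain ⟨hE₁, h62₁⟩ := hA₁' j hj x κ hb
    obtain ⟨hE₂, h62₂⟩ := hA₂' j hj x κ hb
    have hU₁₂ : mgauge U₀ (fun z => (gaugeExp lam z)⁻¹) (cfgExp η A₁) x κ = cfgExp η A₂ x κ := by
      rw [← hE₂, ← hq, mgauge_apply, mgauge_apply, hux, huxe, Pi.inv_apply, Pi.inv_apply, hE₁]
    have hUx : U₀ x κ ∈ U1 𝔸 := hG.le_U1 (hU₀ x κ)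
    exact ineq1109_scaled hη U₀ A₁ A₂ κ hUx hL1 hs hnx hnxe h62₁ h62₂ (hc170 j) hU₁₂
  -- the competitor `u′ = e^{iλ′}` in the socket's currency
  have hcu : 0 < cu := lt_of_le_of_lt (by positivity) hcu₂
  have hdom : ∀ x, ((gaugeExp lam x : 𝔸ˣ) : 𝔸) = (((u₁⁻¹ * u₂) x : 𝔸ˣ) : 𝔸) ∧ IsSelfAdjoint (lam x) ∧ ‖lam x‖ < cu := by
    intro x
    obtain ⟨he, hsa, hn⟩ := hsite x
    exact ⟨he, hsa, lt_of_le_of_lt hn hcu₁⟩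
  have hdomD : ∀ j, j ≤ k → ∀ b ∈ {b : Site d × Fin d | SideTouches (Ω j) b.1 b.2},
      ((L : ℝ) ^ j * η) * ‖covDerivFwd η U₀ b.2 lam b.1‖ < cu :=
    fun j hj b hb => lt_of_le_of_lt (hgrad j hj b hb) hcu₂
  -- the competitor `1 = e^{i0}`
  have hdom1 : ∀ x, ((gaugeExp (fun _ => (0 : 𝔸)) x : 𝔸ˣ) : 𝔸) = (((1 : Site d → 𝔸ˣ) x : 𝔸ˣ) : 𝔸) ∧
      IsSelfAdjoint ((fun _ => (0 : 𝔸)) x) ∧ ‖(fun _ => (0 : 𝔸)) x‖ < cu := by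
    intro x
    refine ⟨?_, IsSelfAdjoint.zero 𝔸, by simpa using hcu⟩
    rw [gaugeExp, smul_zero, B7Prop8Flat.expUnit_zero, Pi.one_apply]
  have hoff1 : ∀ x, x ∉ Ω 0 → (fun _ => (0 : 𝔸)) x = 0 := fun _ _ => rfl
  have hdomD1 : ∀ j, j ≤ k → ∀ b ∈ {b : Site d × Fin d | SideTouches (Ω j) b.1 b.2},
      ((L : ℝ) ^ j * η) * ‖covDerivFwd η U₀ b.2 (fun _ => (0 : 𝔸)) b.1‖ < cu := by
    intro j _ b _
    have h0 : covDerivFwd η U₀ b.2 (fun _ => (0 : 𝔸)) b.1 = 0 := by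
      rw [covDerivFwd, B7Eq78Linearization.conjR_apply, mul_zero, zero_mul, sub_zero, smul_zero]
    rw [h0, norm_zero, mul_zero]
    exact hcu
  -- `u′` solves (1.107): `U₁^{u′⁻¹} = U₂` is in the Landau gauge, `u₁u′ = u₂` satisfies (1.29); so does `1`
  have hLan' : Lan (mgauge U₀ (u₁⁻¹ * u₂)⁻¹ (mgauge U₀ u₁⁻¹ U')) := by
    rw [← hU₁def, hq, hU₂def]; exact hLan₂
  have h129' : Restr129 L k Λ U₀ (u₁ * (u₁⁻¹ * u₂)) := by rw [mul_inv_cancel_left]; exact h129₂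
  have hLan1 : Lan (mgauge U₀ (1 : Site d → 𝔸ˣ)⁻¹ (mgauge U₀ u₁⁻¹ U')) := by
    have h1 : mgauge U₀ (1 : Site d → 𝔸ˣ)⁻¹ (mgauge U₀ u₁⁻¹ U') = mgauge U₀ u₁⁻¹ U' := by
      funext x κ
      simp [mgauge_apply]
    rw [h1]; exact hLan₁
  have h1291 : Restr129 L k Λ U₀ (u₁ * 1) := by rw [mul_one]; exact h129₁
  have huniq := hP5u (u₁⁻¹ * u₂) 1 lam (fun _ => 0) hdom hoff hdomD hdom1 hoff1 hdomD1 hLan' h129' hLan1 h1291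
  funext x
  have h := huniq x
  rw [Pi.mul_apply, Pi.inv_apply, Pi.one_apply, inv_mul_eq_one] at h
  exact h

end Main

#print axioms thm4_unique_eq_lanE

end Literature.MathematicalPhysics.QuantumFieldTheory.Balaban1983to89.B8Thm4UniqueELan

end
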